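import Mathlib
import Literature.NumberTheory.LFunctions.Zhang2022.Section4LineOneBounds
import HarnessLib

/-!
# Zhang (2022) §4, Lemma 4.4: the line `Re w = 1` — "`= F(s,ψ) + Σ_{D⁴<n<P²} ν(n)ψ(n)n^{−s}
# g(P^{9/5}/n) + O(ε)`, `ε = exp{−c𝓛¹⁰}`" (node `Section4.LineOneEval`) — PROVED

Topic `Literature/NumberTheory/LFunctions/Zhang2022` (Landau–Siegel adjudication tree;
verdict-neutral). Y. Zhang, *Discrete mean estimates and the Landau–Siegel zero*,
arXiv:2211.02515v1 (2022) [Zhang2022LandauSiegel] — **an unrefereed manuscript under adjudication**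
— §4, proof of Lemma 4.4, p. 19 (tex L1053–L1061; DAG `Z22:§4.u026`–`u027`):

> By (4.2) and (4.3),
> `(2πi)⁻¹∫_{(1)} L(s+w,ψ)L(s+w,ψχ)P^{(9/5)w} ω₁(w)dw/w = F(s,ψ) + Σ_{D⁴<n<P²} ν(n)ψ(n)n^{−s}g(P^{9/5}/n) + O(ε)`
> where `ε = exp{−c𝓛¹⁰}`.

The campaign's statements file types this as the node `Section4.LineOneEval`
(`Section4Statements.lean`, L1-t3): `∃ c > 0, ∃ C, ForAllLarge: ∀ ψ ∈ Ψ, ∀ s ∈ Ω₃,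
‖perronLine(LL(s+·), 1) − (F(s,ψ) + gSum(s))‖ ≤ C·e^{−c𝓛¹⁰}`. This file PROVES it
(`Section4.lineOneEval_holds`, with `c = 1`, `C = 2`; theorems only, no definition, no new named
fact), from the exact Mellin evaluation `perronLine = Σ'ₙ ν(n)ψ(n)n^{−s}g(P^{9/5}/n)` of
`Section4LineOneMellin` by splitting `n ≤ D⁴` / `D⁴ < n < ⌈P²⌉` / `n ≥ ⌈P²⌉`:

* head (`n ≤ D⁴`, "by (4.2)"): `|g(P^{9/5}/n) − 1| ≤ ½e^{−𝓛³⁰log²(P^{9/5}/n)} ≤ ½e^{−𝓛⁴⁸}`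
  (`log(P^{9/5}/D⁴) ≥ 𝓛⁹`), `|ν(n)ψ(n)n^{−s}| ≤ d(n) ≤ D⁴`, so the head differs from `F(s,ψ)` by at most
  `½D⁸e^{−𝓛⁴⁸} ≤ ½e^{−𝓛¹⁰}` (`Section4.norm_headError_le`, sibling file `Section4LineOneBounds`);
* middle: verbatim the typed `Section4.gSum`;
* tail (`n ≥ ⌈P²⌉`, "by (4.3)"): `g(P^{9/5}/n) ≤ ½e^{−𝓛³⁰(log n − 9𝓛⁹/5)²} ≤ ½n^{−3}e^{−𝓛⁴⁸/50}`, so the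
  tail is at most `(π²/12)e^{−𝓛⁴⁸/50} ≤ e^{−𝓛¹⁰}` (`Section4.norm_tail_le`, sibling file `Section4LineOneBounds`).

Nothing about Theorems 1–2 of the source or about Landau–Siegel zeros is stated or implied.

## References

* Y. Zhang, arXiv:2211.02515v1 (2022), §4 p. 19 (proof of Lemma 4.4), (4.2), (4.3) p. 18.
  [cite: Zhang2022LandauSiegel, §4 Lemma 4.4 (proof) p. 19]
-/

noncomputable section

open Complex Real MeasureTheory Finset
open scoped LSeries.notation

namespace Literature.NumberTheory.LFunctions.Zhang2022.Section4

open Skeleton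
open LSeries (term term_of_ne_zero term_zero)
open GaussWeight (gWeight gWeight_pos gWeight_lt_one abs_gWeight_sub_one_le gWeight_le)

section WithCharacter

variable {D : ℕ} [NeZero D] (χ : DirichletCharacter ℂ D) (x : Chr D)

/-! ### The node `Section4.LineOneEval` HOLDS -/

/-- `Σ_{n<N} t(n) = t(0) + Σ_{1≤n≤D⁴} t(n) + Σ_{D⁴<n<N} t(n)` for `D⁴ + 1 ≤ N`. [folklore] -/
private theorem sum_range_split {M : Type*} [AddCommMonoid M] (t : ℕ → M) {A N : ℕ}
    (hAN : A + 1 ≤ N) :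
    ∑ n ∈ Finset.range N, t n
      = t 0 + ∑ n ∈ Finset.Icc 1 A, t n + ∑ n ∈ Finset.Ioo A N, t n := by
  rw [Finset.range_eq_Ico]
  rw [← Finset.sum_Ico_consecutive t (Nat.zero_le (A + 1)) hAN,
    ← Finset.sum_Ico_consecutive t (Nat.zero_le 1) (Nat.succ_le_succ (Nat.zero_le A))]
  have h0 : Finset.Ico 0 1 = {0} := by decide
  have h1 : Finset.Ico 1 (A + 1) = Finset.Icc 1 A := by
    ext n; simp only [Finset.mem_Ico, Finset.mem_Icc]; omega
  have h2 : Finset.Ico (A + 1) N = Finset.Ioo A N := by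
    ext n; simp only [Finset.mem_Ico, Finset.mem_Ioo]; omega
  rw [h0, h1, h2, Finset.sum_singleton]

/-- **`Z22:§4.u026`–`u027` HOLD** [Z22 p. 19, tex L1053–L1061]: the typed node
`Section4.LineOneEval` — with `c = 1`, `C = 2`, threshold `D ≥ ⌈e²⌉`: for every `ψ ∈ Ψ` and
`s ∈ Ω₃`, `‖(2πi)⁻¹∫_{(1)} L(s+w,ψ)L(s+w,ψχ)P^{(9/5)w}ω₁(w)dw/w − (F(s,ψ) + Σ_{D⁴<n<⌈P²⌉}
ν(n)ψ(n)n^{−s}g(P^{9/5}/n))‖ ≤ 2e^{−𝓛¹⁰}`. From the exact Mellin evaluation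
(`Section4.perronLine_one_eq_tsum`), the head bound (4.2) and the tail bound (4.3). Kernel-checked,
unconditional. [cite: Zhang2022LandauSiegel, §4 Lemma 4.4 (proof) p. 19] -/
theorem lineOneEval_holds : LineOneEval := by
  refine ⟨1, one_pos, 2, ⌈Real.exp 2⌉₊, fun D _ χ hD hq hp x s hs => ?_⟩
  have hℓ2 : 2 ≤ ell D := le_ell_of_ceil_exp_le hD
  have hℓ1 : 1 ≤ ell D := le_trans one_le_two hℓ2
  have hℓ : 0 < ell D := lt_of_lt_of_le zero_lt_one hℓ1
  have hP : 0 < bigP D := Real.exp_pos _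
  have hα : alpha D = Real.pi / ell D ^ 9 := by rw [alpha, bigP, Real.log_exp]
  have hα4 : alpha D ≤ 1 / 4 := by
    rw [hα, div_le_div_iff₀ (by positivity) (by norm_num)]
    have h9 : (2 : ℝ) ^ 9 ≤ ell D ^ 9 := pow_le_pow_left₀ (by norm_num) hℓ2 9
    nlinarith [Real.pi_lt_four]
  obtain ⟨hσ1, hσ2, ht⟩ := hs
  have hs0 : 0 < s.re := by linarith
  -- the Mellin series and its split
  set a : ℕ → ℂ := fun n => nu χ n * x.ψ (n : ZMod x.p) with ha
  set X : ℝ := bigP D ^ (9 / 5 : ℝ) with hXdef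
  set t : ℕ → ℂ := fun n => term a s n * (gW D (X / (n : ℝ)) : ℂ) with htdef
  set N : ℕ := ⌈bigP D ^ 2⌉₊ with hNdef
  have hN : bigP D ^ 2 ≤ (N : ℝ) := Nat.le_ceil _
  have hD4N : D ^ 4 + 1 ≤ N := by
    have h := pow_four_add_one_le_bigP_sq hℓ2
    have : ((D ^ 4 + 1 : ℕ) : ℝ) ≤ (N : ℝ) := by push_cast; exact h.trans hN
    exact_mod_cast this
  have hmellin : perronLine D (fun w => LL χ x (s + w)) 1 = ∑' n : ℕ, t n :=
    perronLine_one_eq_tsum χ x hs0 hℓ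
  -- summability (tail majorant) and the shift decomposition
  obtain ⟨htail_sum, htail_le⟩ := norm_tail_le χ x hℓ2 hs0.le hN
  have htsum : Summable t := by
    rw [← summable_nat_add_iff N]
    convert htail_sum using 1
  have hshift := htsum.sum_add_tsum_nat_add N
  -- the finite part
  have ht0 : t 0 = 0 := by rw [htdef]; simp [term_zero]
  have hfin : ∑ n ∈ Finset.range N, t n
      = (Fpoly χ x s + ∑ n ∈ Finset.Icc 1 (D ^ 4), nu χ n * x.ψ (n : ZMod x.p) * (n : ℂ) ^ (-s)
          * ((gW D (bigP D ^ (9 / 5 : ℝ) / (n : ℝ)) : ℂ) - 1)) + gSum χ x s := by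
    rw [sum_range_split t hD4N, ht0, zero_add]
    congr 1
    · rw [Fpoly, ← Finset.sum_add_distrib]
      refine Finset.sum_congr rfl fun n hn => ?_
      have hn0 : n ≠ 0 := by have := (Finset.mem_Icc.mp hn).1; omega
      rw [htdef, ha]
      simp only
      rw [term_nu_psi_eq χ x hn0]
      ring
    · rw [gSum]
      refine Finset.sum_congr rfl fun n hn => ?_
      have hn0 : n ≠ 0 := by have := (Finset.mem_Ioo.mp hn).1; omega
      rw [htdef, ha]
      simp only
      rw [term_nu_psi_eq χ x hn0]
  -- assemble
  have hhead := norm_headError_le χ x hℓ2 hs0.le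
  have hid : perronLine D (fun w => LL χ x (s + w)) 1 - (Fpoly χ x s + gSum χ x s)
      = (∑ n ∈ Finset.Icc 1 (D ^ 4), nu χ n * x.ψ (n : ZMod x.p) * (n : ℂ) ^ (-s)
          * ((gW D (bigP D ^ (9 / 5 : ℝ) / (n : ℝ)) : ℂ) - 1))
        + ∑' n : ℕ, t (n + N) := by
    rw [hmellin, ← hshift, hfin]; ring
  rw [hid, epsW]
  have htail' : ‖∑' n : ℕ, t (n + N)‖ ≤ Real.exp (-(ell D ^ 10)) := by
    convert htail_le using 3
  calc _ ≤ ‖∑ n ∈ Finset.Icc 1 (D ^ 4), nu χ n * x.ψ (n : ZMod x.p) * (n : ℂ) ^ (-s)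
          * ((gW D (bigP D ^ (9 / 5 : ℝ) / (n : ℝ)) : ℂ) - 1)‖ + ‖∑' n : ℕ, t (n + N)‖ :=
        norm_add_le _ _
    _ ≤ (1 / 2) * Real.exp (-(ell D ^ 10)) + Real.exp (-(ell D ^ 10)) := add_le_add hhead htail'
    _ ≤ 2 * Real.exp (-1 * ell D ^ 10) := by
        rw [show (-1 : ℝ) * ell D ^ 10 = -(ell D ^ 10) by ring]
        nlinarith [Real.exp_pos (-(ell D ^ 10))]

end WithCharacter

end Literature.NumberTheory.LFunctions.Zhang2022.Section4

end
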